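import Literature.Probability.LatticeModels.KCConfigHub
import HarnessLib

/-!
# The seed and the Harnack chain of the sign-condition configuration

Topic `Literature/Probability/LatticeModels`. Continuation of `KCConfigHub.lean`: given hub data
and a Harnack scale `κ` (`400 κ ≤ ℓ`, `seedClear κ ≤ r_h/4`), the **seed point** `zStar` — the
first point of the axis `m + s ν`, `s ≥ 2 r_h`, at distance `85 κ` from `Ωᶜ` — with its boundary
point, the **Harnack chain** from `zStar` down the axis to normal height `65 κ` and then along the
far side of the half-boxes (`|t| ≤ 204 κ`), the chain **windows** (`50κ`-sup-boxes: inside `Ω`,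
off the middle set, off the end zones), the far-side coverage, and the transport path
`Pz = [zStar, yPlus]`.

All `[folklore]`; no named fact.
-/

noncomputable section

open Set Metric

namespace Literature.Probability.LatticeModels

open Site

/-! ### A first-level lemma for continuous functions -/

/-- **First level.** A function continuous on `[a, b]` with `f a > c ≥ f b` reaches the level `c`
a first time `s ∈ (a, b]`, before which it stays above `c`. [folklore] -/
theorem exists_first_level {f : ℝ → ℝ} {a b c : ℝ} (hab : a ≤ b) (hf : ContinuousOn f (Icc a b)) (ha : c < f a) (hb : f b ≤ c) :
    ∃ s, a < s ∧ s ≤ b ∧ f s = c ∧ ∀ s', a ≤ s' → s' < s → c < f s' := by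
  set S : Set ℝ := {s | s ∈ Icc a b ∧ f s ≤ c} with hS
  have hSc : IsClosed S := by
    have : S = Icc a b ∩ f ⁻¹' Iic c := by ext s; simp [hS]
    rw [this]; exact hf.preimage_isClosed_of_isClosed isClosed_Icc isClosed_Iic
  have hne : S.Nonempty := ⟨b, ⟨hab, le_rfl⟩, hb⟩
  have hbdd : BddBelow S := ⟨a, fun s hs => hs.1.1⟩
  set s₀ := sInf S
  have hmem : s₀ ∈ S := hSc.csInf_mem hne hbdd
  have hbefore : ∀ s', a ≤ s' → s' < s₀ → c < f s' := by
    intro s' h1 h2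
    by_contra h; push Not at h
    have : s₀ ≤ s' := csInf_le hbdd ⟨⟨h1, h2.le.trans hmem.1.2⟩, h⟩
    linarith
  have has₀ : a < s₀ := by
    rcases hmem.1.1.lt_or_eq with h | h
    · exact h
    · exact absurd hmem.2 (by rw [← h]; exact not_le.2 ha)
  refine ⟨s₀, has₀, hmem.1.2, le_antisymm hmem.2 ?_, hbefore⟩
  -- `f s₀ ≥ c` by continuity from the left
  have hclosed : IsClosed {s | s ∈ Icc a b ∧ c ≤ f s} := by
    have : {s | s ∈ Icc a b ∧ c ≤ f s} = Icc a b ∩ f ⁻¹' Ici c := by ext s; simp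
    rw [this]; exact hf.preimage_isClosed_of_isClosed isClosed_Icc isClosed_Ici
  have hsub : Ico a s₀ ⊆ {s | s ∈ Icc a b ∧ c ≤ f s} := fun s hs => ⟨⟨hs.1, hs.2.le.trans hmem.1.2⟩, (hbefore s hs.1 hs.2).le⟩
  have : s₀ ∈ closure (Ico a s₀) := by rw [closure_Ico has₀.ne]; exact ⟨has₀.le, le_rfl⟩
  exact (closure_minimal hsub hclosed this).2

/-! ### Frame components and the sup norm -/

/-- The real and imaginary parts of a frame combination are, up to sign, its coefficients. [folklore] -/
theorem abs_re_im_frame (k : Fin 4) (x y : ℝ) :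
    |((x : ℂ) * dirVec k + (y : ℂ) * dirVec (k + 1)).re| ≤ max |x| |y| ∧ |((x : ℂ) * dirVec k + (y : ℂ) * dirVec (k + 1)).im| ≤ max |x| |y| := by
  obtain ⟨h0, h1⟩ := cornerUnit_succ_apply k
  simp only [Complex.add_re, Complex.add_im, Complex.mul_re, Complex.mul_im, Complex.ofReal_re, Complex.ofReal_im, dirVec_re, dirVec_im,
    h0, h1, zero_mul, sub_zero, add_zero, Int.cast_neg]
  rcases cornerUnit_apply_cases k with ⟨e0, e1⟩ | ⟨e0, e1⟩ | ⟨e0, e1⟩ | ⟨e0, e1⟩ <;> simp [e0, e1, abs_neg]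

/-- Frame coordinates are bounded by the sup norm. [folklore] -/
theorem abs_dirCoord_le_sup (k : Fin 4) (v : ℂ) : |dirCoord k v| ≤ max |v.re| |v.im| := by
  simp only [dirCoord]
  rcases cornerUnit_apply_cases k with ⟨e0, e1⟩ | ⟨e0, e1⟩ | ⟨e0, e1⟩ | ⟨e0, e1⟩ <;> simp [e0, e1, abs_neg]

/-- A vector with both components at most `50 κ` has norm `< 71 κ`. [folklore] -/
theorem norm_lt_of_sup_le {v : ℂ} {κ : ℝ} (hκ : 0 < κ) (h1 : |v.re| ≤ 50 * κ) (h2 : |v.im| ≤ 50 * κ) : ‖v‖ < 71 * κ := by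
  have hsq : ‖v‖ ^ 2 < (71 * κ) ^ 2 := by
    rw [Complex.sq_norm, Complex.normSq_apply]
    have a1 := abs_le.1 h1; have a2 := abs_le.1 h2
    nlinarith
  exact (pow_lt_pow_iff_left₀ (norm_nonneg _) (by positivity) two_ne_zero).1 hsq

namespace HubData

variable {Ω : Set ℂ} (hub : HubData Ω)

/-- **The seed scale**: `0 < κ`, `400 κ ≤ ℓ`, `seedClear κ ≤ r_h / 4`. [folklore] -/
structure SeedScale (κ : ℝ) : Prop where
  pos : 0 < κ
  le_ell : 400 * κ ≤ hub.ell
  clear_le : seedClear * κ ≤ hub.rh / 4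

/-! ### The seed point -/

/-- The distance of the axis point `m + s ν` to the complement. [folklore] -/
def axDist (s : ℝ) : ℝ := infDist (hub.ax s) Ωᶜ

/-- `axDist` is continuous. [folklore] -/
theorem continuous_axDist : Continuous hub.axDist := by
  unfold axDist ax
  exact (continuous_infDist_pt _).comp (by fun_prop)

/-- `axDist (2 r_h) ≥ 8 r_h` and `axDist (L ν) = 0`. [folklore] -/
theorem axDist_ends : 8 * hub.rh ≤ hub.axDist (2 * hub.rh) ∧ hub.axDist (hub.L hub.ν) = 0 := by
  obtain ⟨hL, hout, -, -⟩ := hub.ray_spec_ν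
  have hrh := hub.rh_pos
  constructor
  · have hne : (Ωᶜ).Nonempty := ⟨_, hout⟩
    refine (le_infDist hne).2 fun y hy => ?_
    by_contra h; push Not at h
    apply hy; apply hub.closedBall_subset
    rw [mem_closedBall]
    have h1 : dist (hub.ax (2 * hub.rh)) hub.m = 2 * hub.rh := by
      rw [ax, dist_eq_norm, add_sub_cancel_left, norm_mul, Complex.norm_real, Real.norm_eq_abs, hub.norm_ν_τ.1, mul_one, abs_of_pos (by linarith)]
    linarith [dist_triangle y (hub.ax (2 * hub.rh)) hub.m, dist_comm y (hub.ax (2 * hub.rh))]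
  · exact infDist_zero_of_mem (by exact hout)

variable {hub} {κ : ℝ} (S : hub.SeedScale κ)
include S

/-- Bounds on `κ`: `κ ≤ r_h / 40000`, so `100 κ ≤ r_h`, etc. [folklore] -/
theorem SeedScale.bounds : 0 < κ ∧ 40000 * κ ≤ hub.rh ∧ 400 * κ ≤ hub.ell ∧ seedClear * κ ≤ hub.rh / 4 := by
  obtain ⟨-, -, hℓr, -⟩ := hub.scales
  exact ⟨S.pos, by linarith [S.le_ell], S.le_ell, S.clear_le⟩

/-- **The seed parameter** `s*`: the first `s ≥ 2 r_h` with `axDist s = 85 κ`. [folklore] -/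
theorem SeedScale.exists_sStar : ∃ s, 2 * hub.rh < s ∧ s ≤ hub.L hub.ν ∧ hub.axDist s = 85 * κ ∧ ∀ s', 2 * hub.rh ≤ s' → s' < s → 85 * κ < hub.axDist s' := by
  obtain ⟨h8, h0⟩ := hub.axDist_ends
  obtain ⟨hκ, hκr, -, -⟩ := S.bounds
  obtain ⟨hL, -, -, -⟩ := hub.ray_spec_ν
  exact exists_first_level (by linarith [hub.rh_pos]) hub.continuous_axDist.continuousOn (by linarith) (by rw [h0]; positivity)

/-- The seed parameter. [folklore] -/
def SeedScale.sStar (S' : hub.SeedScale κ) : ℝ := Classical.choose S'.exists_sStar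

/-- Specification of the seed parameter. [folklore] -/
theorem SeedScale.sStar_spec : 2 * hub.rh < S.sStar ∧ S.sStar ≤ hub.L hub.ν ∧ hub.axDist S.sStar = 85 * κ ∧
    ∀ s', 2 * hub.rh ≤ s' → s' < S.sStar → 85 * κ < hub.axDist s' := Classical.choose_spec S.exists_sStar

/-- The seed point `zStar = m + s* ν`. [folklore] -/
def SeedScale.zStar (S' : hub.SeedScale κ) : ℂ := hub.ax S'.sStar

/-- `s* < L ν`: the seed point is in `Ω`. [folklore] -/
theorem SeedScale.sStar_lt : S.sStar < hub.L hub.ν ∧ S.zStar ∈ Ω := by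
  obtain ⟨h2, hle, hdist, -⟩ := S.sStar_spec
  obtain ⟨hL, hout, hbelow, -⟩ := hub.ray_spec_ν
  have hκ := S.pos
  have hlt : S.sStar < hub.L hub.ν := by
    rcases hle.lt_or_eq with h | h
    · exact h
    · exfalso
      have : hub.axDist S.sStar = 0 := by rw [h]; exact hub.axDist_ends.2
      rw [this] at hdist; linarith
  exact ⟨hlt, hbelow _ (by linarith [hub.rh_pos]) hlt⟩

/-- **Points near the axis between `2 r_h` and `s*` are in `Ω`**: within distance `< 85 κ`. [folklore] -/
theorem SeedScale.mem_of_dist_lt {s : ℝ} (hs1 : 2 * hub.rh ≤ s) (hs2 : s ≤ S.sStar) {y : ℂ} (hy : dist y (hub.ax s) < 85 * κ) : y ∈ Ω := by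
  obtain ⟨h2, hle, hdist, hbefore⟩ := S.sStar_spec
  by_contra h
  have h1 : hub.axDist s ≤ dist (hub.ax s) y := infDist_le_dist_of_mem (show y ∈ Ωᶜ from h)
  rw [dist_comm] at h1
  rcases hs2.lt_or_eq with hs2 | rfl
  · have := hbefore s hs1 hs2; linarith
  · linarith

/-- **The seed boundary point**: a boundary point of `Ω` at distance `85 κ` from `zStar`. [folklore] -/
theorem SeedScale.exists_seed_frontier : ∃ q ∈ frontier Ω, dist q S.zStar ≤ 100 * κ := by
  obtain ⟨-, hz⟩ := S.sStar_lt
  obtain ⟨-, hout, -, -⟩ := hub.ray_spec_ν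
  obtain ⟨q, hq, -, hqd, -, -⟩ := exists_nearest_compl hub.isOpen ⟨_, hout⟩ hz
  refine ⟨q, hq, ?_⟩
  have : infDist S.zStar Ωᶜ = 85 * κ := S.sStar_spec.2.2.1
  rw [dist_comm, hqd]
  show infDist S.zStar Ωᶜ ≤ 100 * κ
  rw [this]; linarith [S.pos]

/-- Frame coordinates of the seed point: `N = s* - r_h ≥ r_h`, `T = 0`. [folklore] -/
theorem SeedScale.NT_zStar : hub.N S.zStar = S.sStar - hub.rh ∧ hub.T S.zStar = 0 ∧ hub.rh < hub.N S.zStar := by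
  obtain ⟨h1, h2⟩ := hub.NT_axis S.sStar
  have := S.sStar_spec.1
  exact ⟨h1, h2, by rw [show hub.N S.zStar = S.sStar - hub.rh from h1]; linarith⟩

/-! ### The Harnack chain -/

/-- The normal coordinate of the seed point. [folklore] -/
def SeedScale.NStar (S' : hub.SeedScale κ) : ℝ := S'.sStar - hub.rh

/-- The number of steps of the descent down the axis. [folklore] -/
def SeedScale.J₁ (S' : hub.SeedScale κ) : ℕ := ⌈(S'.NStar - 65 * κ) / (6 * κ)⌉₊

/-- The total number of steps of the chain. [folklore] -/
def SeedScale.Jc (S' : hub.SeedScale κ) : ℕ := S'.J₁ + 102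

/-- The normal coordinate of the chain points. [folklore] -/
def SeedScale.chainN (S' : hub.SeedScale κ) (j : ℕ) : ℝ := max (S'.NStar - 6 * κ * j) (65 * κ)

/-- The tangential coordinate of the chain points. [folklore] -/
def SeedScale.chainT (S' : hub.SeedScale κ) (j : ℕ) : ℝ := if j ≤ S'.J₁ then 0 else 6 * κ * (|((j - S'.J₁ : ℕ) : ℝ) - 34| - 34)

/-- The chain points `w_j = pmid + N_j ν + T_j τ`. [folklore] -/
def SeedScale.wc (S' : hub.SeedScale κ) (j : ℕ) : ℂ := hub.pmid + ((S'.chainN j : ℝ) : ℂ) * hub.ν + ((S'.chainT j : ℝ) : ℂ) * hub.τ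

/-- `N* ≥ r_h`. [folklore] -/
theorem SeedScale.NStar_gt : hub.rh < S.NStar := by
  have := S.sStar_spec.1; rw [SeedScale.NStar]; linarith

/-- Frame coordinates of the chain points. [folklore] -/
theorem SeedScale.NT_wc (j : ℕ) : hub.N (S.wc j) = S.chainN j ∧ hub.T (S.wc j) = S.chainT j := by
  have : S.wc j - hub.pmid = ((S.chainN j : ℝ) : ℂ) * hub.ν + ((S.chainT j : ℝ) : ℂ) * hub.τ := by rw [SeedScale.wc]; ring
  simp only [HubData.N, HubData.T, this]
  exact dirCoord_frame_comb hub.km _ _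

/-- Bounds on the normal coordinates of the chain: `65 κ ≤ N_j ≤ N*`, and `N_j = 65 κ` for `j ≥ J₁`. [folklore] -/
theorem SeedScale.chainN_bounds (j : ℕ) : 65 * κ ≤ S.chainN j ∧ S.chainN j ≤ S.NStar ∧ (S.J₁ ≤ j → S.chainN j = 65 * κ) := by
  have hκ := S.pos
  have hN := S.NStar_gt
  obtain ⟨-, hκr, -, -⟩ := S.bounds
  refine ⟨le_max_right _ _, max_le (by nlinarith) (by linarith), fun hj => max_eq_right ?_⟩
  have h1 : (S.NStar - 65 * κ) / (6 * κ) ≤ S.J₁ := Nat.le_ceil _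
  have h2 : (S.J₁ : ℝ) ≤ j := by exact_mod_cast hj
  rw [div_le_iff₀ (by positivity)] at h1
  nlinarith

/-- Bounds on the tangential coordinates of the chain: `T_j = 0` for `j ≤ J₁`, `|T_j| ≤ 204 κ` for `j ≤ J`. [folklore] -/
theorem SeedScale.chainT_bounds (j : ℕ) : (j ≤ S.J₁ → S.chainT j = 0) ∧ (j ≤ S.Jc → |S.chainT j| ≤ 204 * κ) := by
  have hκ := S.pos
  refine ⟨fun hj => if_pos hj, fun hj => ?_⟩
  unfold SeedScale.chainT
  split_ifs with h
  · rw [abs_zero]; positivity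
  · have hi : ((j - S.J₁ : ℕ) : ℝ) ≤ 102 := by
      have : j - S.J₁ ≤ 102 := by rw [SeedScale.Jc] at hj; omega
      exact_mod_cast this
    have hi0 : (0 : ℝ) ≤ ((j - S.J₁ : ℕ) : ℝ) := by positivity
    rw [abs_mul, abs_of_pos (by positivity : (0 : ℝ) < 6 * κ)]
    have : |(|((j - S.J₁ : ℕ) : ℝ) - 34| - 34)| ≤ 34 := by
      rw [abs_le]; constructor
      · linarith [abs_nonneg (((j - S.J₁ : ℕ) : ℝ) - 34)]
      · have : |((j - S.J₁ : ℕ) : ℝ) - 34| ≤ 68 := by rw [abs_le]; constructor <;> linarith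
        linarith
    nlinarith

/-- **The chain starts at the seed point.** [folklore] -/
theorem SeedScale.wc_zero : S.wc 0 = S.zStar := by
  have hκ := S.pos
  obtain ⟨-, hκr, -, -⟩ := S.bounds
  have hN := S.NStar_gt
  have h1 : S.chainN 0 = S.NStar := by
    rw [SeedScale.chainN, Nat.cast_zero, mul_zero, sub_zero]; exact max_eq_left (by linarith)
  have h2 : S.chainT 0 = 0 := (S.chainT_bounds 0).1 (Nat.zero_le _)
  rw [SeedScale.wc, h1, h2, SeedScale.zStar, HubData.ax, HubData.pmid, SeedScale.NStar]
  push_cast; ring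

/-- **The chain steps are at most `6 κ` in each coordinate.** [folklore] -/
theorem SeedScale.wc_step (j : ℕ) : |(S.wc (j + 1) - S.wc j).re| ≤ 6 * κ ∧ |(S.wc (j + 1) - S.wc j).im| ≤ 6 * κ := by
  have hκ := S.pos
  have hdiff : S.wc (j + 1) - S.wc j = ((S.chainN (j + 1) - S.chainN j : ℝ) : ℂ) * hub.ν + ((S.chainT (j + 1) - S.chainT j : ℝ) : ℂ) * hub.τ := by
    simp only [SeedScale.wc]; push_cast; ring
  have hN : |S.chainN (j + 1) - S.chainN j| ≤ 6 * κ := by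
    simp only [SeedScale.chainN]
    refine (abs_max_sub_max_le_abs _ _ _).trans ?_
    rw [show S.NStar - 6 * κ * ((j + 1 : ℕ) : ℝ) - (S.NStar - 6 * κ * (j : ℝ)) = -(6 * κ) from by push_cast; ring, abs_neg, abs_of_pos (by positivity)]
  have hT : |S.chainT (j + 1) - S.chainT j| ≤ 6 * κ := by
    simp only [SeedScale.chainT]
    by_cases h1 : j + 1 ≤ S.J₁
    · rw [if_pos h1, if_pos (by omega)]; simp; positivity
    by_cases h2 : j ≤ S.J₁
    · have hj : j = S.J₁ := by omega
      rw [if_neg h1, if_pos h2, hj, show S.J₁ + 1 - S.J₁ = 1 from by omega]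
      norm_num [abs_of_pos hκ]
    · rw [if_neg h1, if_neg h2, ← mul_sub]
      rw [show (|((j + 1 - S.J₁ : ℕ) : ℝ) - 34| - 34) - (|((j - S.J₁ : ℕ) : ℝ) - 34| - 34) =
        |((j + 1 - S.J₁ : ℕ) : ℝ) - 34| - |((j - S.J₁ : ℕ) : ℝ) - 34| from by ring]
      rw [abs_mul, abs_of_pos (by positivity : (0 : ℝ) < 6 * κ)]
      have : |(|((j + 1 - S.J₁ : ℕ) : ℝ) - 34| - |((j - S.J₁ : ℕ) : ℝ) - 34|)| ≤ 1 := by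
        refine (abs_abs_sub_abs_le _ _).trans ?_
        rw [show ((j + 1 - S.J₁ : ℕ) : ℝ) - 34 - (((j - S.J₁ : ℕ) : ℝ) - 34) = 1 from by
          rw [show j + 1 - S.J₁ = (j - S.J₁) + 1 from by omega]; push_cast; ring]
        simp
      nlinarith
  rw [hdiff]
  obtain ⟨h1, h2⟩ := abs_re_im_frame hub.km (S.chainN (j + 1) - S.chainN j) (S.chainT (j + 1) - S.chainT j)
  exact ⟨h1.trans (max_le hN hT), h2.trans (max_le hN hT)⟩

/-- **The far side is covered by the chain**: every point `pmid + 65κ ν + t τ`, `|t| ≤ 200 κ`, is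
within `10 κ` (both coordinates) of a chain point. [folklore] -/
theorem SeedScale.farside (t : ℝ) (ht : |t| ≤ 200 * κ) : ∃ j, j ≤ S.Jc ∧
    |(S.wc j - (hub.pmid + ((65 * κ : ℝ) : ℂ) * hub.ν + (t : ℂ) * hub.τ)).re| ≤ 10 * κ ∧
    |(S.wc j - (hub.pmid + ((65 * κ : ℝ) : ℂ) * hub.ν + (t : ℂ) * hub.τ)).im| ≤ 10 * κ := by
  have hκ := S.pos
  rw [abs_le] at ht
  -- the nearest integer `n` to `t/(6κ)` and the index `i = 68 + n ∈ [34, 102]`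
  set n : ℤ := ⌊t / (6 * κ) + 1 / 2⌋ with hn
  have hn1 : (n : ℝ) ≤ t / (6 * κ) + 1 / 2 := Int.floor_le _
  have hn2 : t / (6 * κ) + 1 / 2 < n + 1 := Int.lt_floor_add_one _
  have ht1 : -(200 / 6 : ℝ) ≤ t / (6 * κ) := by rw [le_div_iff₀ (by positivity)]; linarith
  have ht2 : t / (6 * κ) ≤ 200 / 6 := by rw [div_le_iff₀ (by positivity)]; linarith
  have hn3 : -34 ≤ n := by
    have : (-34 : ℝ) < n + 1 := by linarith
    have : (-35 : ℤ) < n := by exact_mod_cast (by linarith : (-35 : ℝ) < n)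
    omega
  have hn4 : n ≤ 33 := by
    have : (n : ℝ) < 34 := by linarith
    exact_mod_cast Int.le_of_lt_add_one (by exact_mod_cast this : n < 33 + 1)
  obtain ⟨i, hi⟩ : ∃ i : ℕ, (i : ℤ) = 68 + n := ⟨(68 + n).toNat, Int.toNat_of_nonneg (by omega)⟩
  have hi1 : 34 ≤ i := by omega
  have hi2 : i ≤ 102 := by omega
  refine ⟨S.J₁ + i, by rw [SeedScale.Jc]; omega, ?_⟩
  have hN : S.chainN (S.J₁ + i) = 65 * κ := (S.chainN_bounds _).2.2 (by omega)
  have hT : S.chainT (S.J₁ + i) = 6 * κ * n := by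
    rw [SeedScale.chainT, if_neg (by omega), show S.J₁ + i - S.J₁ = i from by omega]
    have hir : (i : ℝ) = 68 + n := by exact_mod_cast hi
    have h34 : (-34 : ℝ) ≤ n := by exact_mod_cast hn3
    rw [hir, show (68 + (n : ℝ) - 34) = n + 34 from by ring, abs_of_nonneg (by linarith)]
    ring
  have hdiff : S.wc (S.J₁ + i) - (hub.pmid + ((65 * κ : ℝ) : ℂ) * hub.ν + (t : ℂ) * hub.τ) = ((0 : ℝ) : ℂ) * hub.ν + ((6 * κ * n - t : ℝ) : ℂ) * hub.τ := by
    rw [SeedScale.wc, hN, hT]; push_cast; ring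
  rw [hdiff]
  obtain ⟨h1, h2⟩ := abs_re_im_frame hub.km 0 (6 * κ * n - t)
  have hb : max |(0 : ℝ)| |6 * κ * n - t| ≤ 10 * κ := by
    rw [abs_zero]; refine max_le (by positivity) ?_
    rw [abs_le]
    have e1 : 6 * κ * n - t = 6 * κ * (n - t / (6 * κ)) := by field_simp
    rw [e1]
    constructor <;> nlinarith
  exact ⟨h1.trans hb, h2.trans hb⟩

/-! ### The chain windows -/

/-- Frame coordinates of the points of a chain window: `15 κ ≤ N ≤ N* + 50 κ`, `|T| ≤ 254 κ`, and
`N ≤ 165 κ` unless `T_j = 0`. [folklore] -/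
theorem SeedScale.frame_window {j : ℕ} (hj : j ≤ S.Jc) {y : ℂ} (hy : y ∈ supBox (S.wc j) (50 * κ)) :
    15 * κ ≤ hub.N y ∧ hub.N y ≤ S.NStar + 50 * κ ∧ |hub.T y| ≤ 254 * κ ∧ |hub.N y - S.chainN j| ≤ 50 * κ ∧ |hub.T y - S.chainT j| ≤ 50 * κ := by
  obtain ⟨h1, h2⟩ := hy
  obtain ⟨nw, tw⟩ := S.NT_wc j
  obtain ⟨b1, b2, -⟩ := S.chainN_bounds j
  obtain ⟨-, b4⟩ := S.chainT_bounds j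
  have hN : |hub.N y - S.chainN j| ≤ 50 * κ := by
    rw [← nw, show hub.N y - hub.N (S.wc j) = dirCoord hub.km (y - S.wc j) from by rw [HubData.N, HubData.N, ← dirCoord_sub]; congr 1; ring]
    exact (abs_dirCoord_le_sup _ _).trans (max_le h1 h2)
  have hT : |hub.T y - S.chainT j| ≤ 50 * κ := by
    rw [← tw, show hub.T y - hub.T (S.wc j) = dirCoord (hub.km + 1) (y - S.wc j) from by rw [HubData.T, HubData.T, ← dirCoord_sub]; congr 1; ring]
    exact (abs_dirCoord_le_sup _ _).trans (max_le h1 h2)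
  have hT4 := b4 hj
  rw [abs_le] at hN hT hT4
  refine ⟨by linarith, by linarith, ?_, abs_le.2 hN, abs_le.2 hT⟩
  rw [abs_le]; constructor <;> linarith

/-- **The chain windows lie in `Ω`.** [folklore] -/
theorem SeedScale.window_subset {j : ℕ} (hj : j ≤ S.Jc) : supBox (S.wc j) (50 * κ) ⊆ Ω := by
  intro y hy
  have hκ := S.pos
  obtain ⟨-, hκr, -, -⟩ := S.bounds
  obtain ⟨h1, h2⟩ := hy
  have hnorm : ‖y - S.wc j‖ < 71 * κ := norm_lt_of_sup_le hκ h1 h2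
  obtain ⟨b1, b2, b3⟩ := S.chainN_bounds j
  obtain ⟨b4, b5⟩ := S.chainT_bounds j
  by_cases hjJ : j ≤ S.J₁
  · -- on the axis: `w_j = ax (r_h + N_j)` with `2 r_h ≤ r_h + N_j ≤ s*` or inside the hub ball
    have hT0 := b4 hjJ
    have hw : S.wc j = hub.ax (hub.rh + S.chainN j) := by
      rw [SeedScale.wc, hT0, HubData.ax, HubData.pmid]; push_cast; ring
    by_cases hbig : hub.rh ≤ S.chainN j
    · refine S.mem_of_dist_lt (s := hub.rh + S.chainN j) (by linarith) (by rw [SeedScale.NStar] at b2; linarith) ?_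
      rw [← hw, dist_eq_norm]; linarith
    · push Not at hbig
      apply hub.closedBall_subset
      rw [mem_closedBall, dist_eq_norm]
      have h3 : ‖S.wc j - hub.m‖ ≤ hub.rh + S.chainN j := by
        rw [hw, HubData.ax, add_sub_cancel_left, norm_mul, Complex.norm_real, Real.norm_eq_abs, hub.norm_ν_τ.1, mul_one, abs_of_pos (by linarith)]
      calc ‖y - hub.m‖ = ‖(y - S.wc j) + (S.wc j - hub.m)‖ := by congr 1; ring
        _ ≤ ‖y - S.wc j‖ + ‖S.wc j - hub.m‖ := norm_add_le _ _
        _ ≤ 10 * hub.rh := by linarith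
  · -- on the far side: inside the hub ball
    push Not at hjJ
    have hN := b3 hjJ.le
    have hT := b5 hj
    apply hub.closedBall_subset
    rw [mem_closedBall, dist_eq_norm]
    have h3 : ‖S.wc j - hub.m‖ ≤ hub.rh + 65 * κ + 204 * κ := by
      have : S.wc j - hub.m = ((hub.rh + S.chainN j : ℝ) : ℂ) * hub.ν + ((S.chainT j : ℝ) : ℂ) * hub.τ := by
        rw [SeedScale.wc, HubData.pmid]; push_cast; ring
      rw [this]
      refine (norm_le_abs_dirCoord_add hub.km _).trans ?_
      obtain ⟨e1, e2⟩ := dirCoord_frame_comb hub.km (hub.rh + S.chainN j) (S.chainT j)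
      rw [show hub.ν = dirVec hub.km from rfl, show hub.τ = dirVec (hub.km + 1) from rfl, e1, e2, hN,
        abs_of_pos (by linarith [hub.rh_pos])]
      linarith
    calc ‖y - hub.m‖ = ‖(y - S.wc j) + (S.wc j - hub.m)‖ := by congr 1; ring
      _ ≤ ‖y - S.wc j‖ + ‖S.wc j - hub.m‖ := norm_add_le _ _
      _ ≤ 10 * hub.rh := by linarith

/-- **The chain windows miss the middle set.** [folklore] -/
theorem SeedScale.window_not_mem_MsetH {j : ℕ} (hj : j ≤ S.Jc) {t : ℝ} (ht : t ≤ hub.rh) {y : ℂ} (hy : y ∈ supBox (S.wc j) (50 * κ)) :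
    y ∉ hub.MsetH t := by
  intro hmem
  obtain ⟨h1, -, h3, -⟩ := S.frame_window hj hy
  obtain ⟨-, h2, -⟩ := hub.frame_MsetH ht hmem
  obtain ⟨hκ, -, hκℓ, -⟩ := S.bounds
  have := h2 (by linarith)
  linarith

/-- **The chain windows miss the end zones** (`ℓ¹`-radius `≤ r_h/10` about `z₀±`). [folklore] -/
theorem SeedScale.window_far_from_zone {j : ℕ} (hj : j ≤ S.Jc) {sgn t : ℝ} (hs : sgn = 1 ∨ sgn = -1) (ht : t ≤ hub.rh) {y : ℂ}
    (hy : y ∈ supBox (S.wc j) (50 * κ)) : hub.rh / 10 < l1norm (y - hub.z0 sgn t) := by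
  by_contra h; push Not at h
  have h4 := hub.frame_zone hs ht h
  obtain ⟨-, -, h3, -⟩ := S.frame_window hj hy
  obtain ⟨hκ, hκr, -, -⟩ := S.bounds
  rw [abs_le] at h3
  rcases hs with rfl | rfl <;> linarith

/-! ### The seed ball and the transport path `Pz` -/

/-- **The seed ball misses the middle set.** [folklore] -/
theorem SeedScale.seedBall_not_mem_MsetH {t : ℝ} (ht : t ≤ hub.rh) {y : ℂ} (hy : y ∈ closedBall S.zStar (seedClear * κ)) : y ∉ hub.MsetH t := by
  intro hmem
  obtain ⟨-, -, h3⟩ := hub.frame_MsetH ht hmem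
  obtain ⟨-, -, -, hcl⟩ := S.bounds
  obtain ⟨nz, tz, hN⟩ := S.NT_zStar
  rw [mem_closedBall, dist_eq_norm] at hy
  obtain ⟨a1, a2⟩ := hub.abs_NT_sub_le y S.zStar
  rw [tz, sub_zero] at a2
  rw [abs_le] at a1
  have hrh := hub.rh_pos
  have := h3 (by linarith)
  linarith

/-- **The seed ball is far from the end zones**: `2 r_h + seedClear κ ≤ dist w zStar` for `w` in an end zone. [folklore] -/
theorem SeedScale.far_end_seed {sgn t : ℝ} (hs : sgn = 1 ∨ sgn = -1) (ht : t ≤ hub.rh) {w : ℂ} (hw : l1norm (w - hub.z0 sgn t) ≤ hub.rh / 10) :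
    2 * hub.rh + seedClear * κ ≤ dist w S.zStar := by
  have h4 := hub.frame_zone hs ht hw
  obtain ⟨-, -, -, hcl⟩ := S.bounds
  obtain ⟨-, tz, -⟩ := S.NT_zStar
  obtain ⟨-, a2⟩ := hub.abs_NT_sub_le w S.zStar
  rw [tz, sub_zero] at a2
  rw [dist_eq_norm]
  have : 4 * hub.rh ≤ |hub.T w| := by
    rcases hs with rfl | rfl
    · rw [one_mul] at h4; exact h4.trans (le_abs_self _)
    · rw [neg_one_mul] at h4; exact h4.trans (neg_le_abs _)
  have hrh := hub.rh_pos
  linarith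

/-- The transport path from the seed to the seed side of the flat piece: the axis segment. [folklore] -/
def SeedScale.Pz (S' : hub.SeedScale κ) : Path S'.zStar (hub.pmid + ((hub.ell : ℝ) : ℂ) * hub.ν) := Path.segment _ _

/-- Points of `Pz` are axis points `ax s`, `r_h + ℓ ≤ s ≤ s*`. [folklore] -/
theorem SeedScale.exists_of_mem_Pz {x : ℂ} (hx : x ∈ range S.Pz) : ∃ s, hub.rh + hub.ell ≤ s ∧ s ≤ S.sStar ∧ x = hub.ax s := by
  rw [SeedScale.Pz, Path.range_segment, segment_symm, hub.ax_eq.2.1] at hx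
  have h1 := S.sStar_spec.1
  have hℓ := hub.scales.2.1; have := hub.scales.2.2.1
  obtain ⟨s, hs1, hs2, rfl⟩ := hub.segment_ray_subset hub.ν (s₁ := hub.rh + hub.ell) (s₂ := S.sStar) (by linarith) hx
  exact ⟨s, hs1, hs2, rfl⟩

/-- **`Pz` misses the middle set, lies in `Ω`, and has `T = 0`.** [folklore] -/
theorem SeedScale.Pz_spec {t : ℝ} (ht : t ≤ hub.rh) {x : ℂ} (hx : x ∈ range S.Pz) : x ∉ hub.MsetH t ∧ x ∈ Ω ∧ hub.T x = 0 ∧ hub.ell ≤ hub.N x := by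
  obtain ⟨s, hs1, hs2, rfl⟩ := S.exists_of_mem_Pz hx
  have hℓ := hub.scales.2.1
  obtain ⟨hlt, -⟩ := S.sStar_lt
  obtain ⟨-, -, hbelow, -⟩ := hub.ray_spec_ν
  obtain ⟨hn, htc⟩ := hub.NT_axis s
  refine ⟨hub.ax_not_mem_MsetH ht (Or.inr (by linarith)), hbelow s (by linarith [hub.rh_pos]) (by linarith), htc, ?_⟩
  rw [HubData.ax, hn]; linarith

/-- `Pz` is far from the end zones. [folklore] -/
theorem SeedScale.Pz_far_from_zone {sgn t : ℝ} (hs : sgn = 1 ∨ sgn = -1) (ht : t ≤ hub.rh) {x : ℂ} (hx : x ∈ range S.Pz) :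
    hub.rh / 10 < l1norm (x - hub.z0 sgn t) := by
  by_contra h; push Not at h
  have h4 := hub.frame_zone hs ht h
  obtain ⟨-, -, hT, -⟩ := S.Pz_spec ht hx
  rw [hT, mul_zero] at h4
  linarith [hub.rh_pos]

end HubData

end Literature.Probability.LatticeModels
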